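import Literature.Analysis.FluidPDE.KNSSTypeII
import HarnessLib

/-!
# KNSS 2009, Theorem 6.2 (axisymmetric, Type I rate, decay at infinity ⇒ bounded): the
# decomposition of `KNSS2009_regularity_typeI_rate` along its printed proof

Analysis/FluidPDE facts file on the discharge path of the named fact
`Literature.Analysis.FluidPDE.KNSS2009_regularity_typeI_rate` (`KNSSTypeII.lean`) — Koch–
Nadirashvili–Seregin–Šverák, Acta Math. 203 (2009) = arXiv:0709.3599, **Theorem 6.2** (label
`typetwotime`, arXiv p. 12), rendered for classical solutions on `(0, T)` bounded on the
sub-slabs. The printed proof (arXiv pp. 12–13) has the following architecture.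

1. *Reduction to Theorem 6.1.* "We define `f(x, t) = |x'| |u(x, t)|` … By Theorem 6.1, it is
   enough to prove that `f` is bounded in `ℝ³ × (0, T)`." (Theorem 6.1 is the named fact
   `KNSS2009_regularity_bound_C_over_r`.)
2. *Blow-up sequence.* If `f` is unbounded, pick `t_k ↗ T`, `x_k` with
   `M_k = f(x_k, t_k) = sup_{t ≤ t_k} f ↗ ∞`; `λ_k = |x'_k|` is bounded by (assumption2).
3. *First rescaling* `v⁽ᵏ⁾(y, s) = λ_k u(λ_k y', λ_k y₃ + x_{3k}, T + λ_k² s)`: by the scale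
   invariance of (assumption1), `|v⁽ᵏ⁾| ≤ C/√(−s)`; `|v⁽ᵏ⁾(y, s)| ≤ M_k/|y'|` for `s ≤ s_k =
   −(T − t_k)λ_k⁻²`; `|v⁽ᵏ⁾(·, s_k)| = M_k` on the unit circle; hence `s_k ≥ −C²M_k⁻²`, and by
   `min(1/a, 1/b) ≤ 2/(a + b)`, `|v⁽ᵏ⁾(y, s)| ≤ 2CM_k/(M_k√(−s) + C|y'|)`.
4. *Second rescaling* `w⁽ᵏ⁾(x, τ) = M_k⁻¹ v⁽ᵏ⁾(e₁ + x/M_k, s_k + τ/M_k²)` on `(A_k, 0]`,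
   `A_k → −∞`: outside the cylinders `𝒞_k = {√((x₁ + M_k)² + x₂²) ≤ M_k/2}` one has
   `|w⁽ᵏ⁾| ≤ 2` (wkbound); `|w⁽ᵏ⁾(x, τ)| ≤ 2CM_k/(M_k√(−τ) + C√((x₁ + M_k)² + x₂²))` (wkbound2);
   `|w⁽ᵏ⁾(x, τ)| ≤ C/√(−τ)` (wkbound3); `|w⁽ᵏ⁾(0, 0)| = 1`; and `w⁽ᵏ⁾(·, τ)` is axisymmetric
   about the vertical axis through `−M_k e₁`.
5. *Compactness and Liouville.* The `w⁽ᵏ⁾` are mild (first paragraph of the proof: under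
   (assumption2), "`u` is a mild solution", by the decomposition of Lemma 3.1), so by (wkbound3)
   and Lemma 6.1 (compactness of bounded mild solutions, from the regularity theory of §4) a
   subsequence converges locally uniformly on `ℝ³ × (−∞, 0)` to an ancient mild solution `w`,
   `|w| ≤ 2` by (wkbound); `w` is independent of `x₂` ("since the solutions `v⁽ᵏ⁾` are
   axi-symmetric and `M_k ↗ ∞`"); Theorem 5.1 (the two-dimensional Liouville theorem) and
   Remark 6.1 applied to `(w₁, w₃)` give `(w₁, w₃) = 0`, whence `w = 0`.
6. *The vertex.* The representation formula (3.3) on `ℝ³ × (−1, 0)` with datum `w⁽ᵏ⁾(·, −1)`,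
   the kernel decay (3.8), (wkbound), (wkbound2) and `I(M) → 0` give uniform convergence
   `w⁽ᵏ⁾ → w` on `B̄(0, 1) × [−1, 0]`, so `|w(0, 0)| = 1` — a contradiction.

Steps 1–4 are elementary (choices, the Navier–Stokes scaling and translations, bookkeeping of
the three bounds) and are **proved** in the tree (`KNSSTypeIRateSelection`,
`KNSSTypeIRateRescaling`, `KNSSTypeIRateProofs`); so is the elementary part of Step 5, the
independence of `x₂` of a locally uniform limit of fields axisymmetric about receding axes
(`KNSSTypeIRateLimit`). Steps 5–6 are the analytic core: they use
Lemma 3.1, §4, Lemma 6.1, Theorem 5.1, Remark 6.1, (3.3) and (3.8) of the source — the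
regularity and compactness theory of bounded mild solutions and the planar Liouville theorem,
none of which is in Mathlib or the tree (Theorem 5.1 is itself the named fact
`KNSS2009_liouville_planar`). This file vendors

* `KNSS2009_typeI_rate_rMulNorm_bounded` — the **main step** (the statement proved on
  pp. 12–13 after the sentence "By Theorem 6.1, it is enough to prove that `f` is bounded"):
  under the hypotheses of Theorem 6.2, `|x'| |u|` is bounded on `ℝ³ × (0, T)` (named fact);
* `KNSS2009_typeI_rate_blowupSequence` — **Steps 5–6 in the form in which the proof uses
  them**: for a sequence of classical solutions `w⁽ᵏ⁾` on `ℝ³ × (A_k, B_k)`, `A_k → −∞`,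
  `B_k > 0`, `M_k → ∞`, with the symmetry and the three bounds of Step 4, `w⁽ᵏ⁾(0, 0) → 0`
  (named fact; see its docstring for the clause-by-clause correspondence);

and **proves** the reduction of Step 1,
`KNSS2009_regularity_typeI_rate_of_parts : KNSS2009_regularity_bound_C_over_r →
KNSS2009_typeI_rate_rMulNorm_bounded → KNSS2009_regularity_typeI_rate`.
The companion proof files establish
`KNSS2009_typeI_rate_rMulNorm_bounded_of_blowupSequence : KNSS2009_typeI_rate_blowupSequence →
KNSS2009_typeI_rate_rMulNorm_bounded` (Steps 2–4), so that Theorem 6.2 as vendored rests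
exactly on Theorem 6.1 and on Steps 5–6.

## Rendering choices

* **Solution class.** As in `KNSSTypeII`: classical solutions (`IsClassicalNSSolutionOn`) on open
  time intervals, bounded on sub-slabs, in place of KNSS's bounded weak/mild solutions (a
  classical solution bounded on a slab is a bounded weak solution there). In
  `KNSS2009_typeI_rate_blowupSequence` the mildness of the `w⁽ᵏ⁾`, which the printed Step 5
  takes from the first paragraph of the proof, is not a hypothesis: in the classical rendering
  it is part of what Steps 5–6 assert (a bounded classical solution on `ℝ³ × [a, 0]` whose
  slices decay at horizontal infinity — here by (wkbound2) — has no parasitic part `b(t)` in the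
  decomposition of Lemma 3.1, exactly as in the proof of Theorem 6.1, last paragraph, p. 12).
* **Constants.** The printed `2` of (wkbound) and the shape `2CM_k/(M_k√(−τ) + C ρ)` of
  (wkbound2) come from choosing exact maximisers `M_k = f(x_k, t_k) = H(t_k)`; the suprema need
  not be attained, and the proof files use near-maximisers (`f ≤ 2M_k` up to time `t_k`), which
  changes these constants. The fact therefore takes arbitrary constants `C, K > 0`:
  `|w⁽ᵏ⁾| ≤ K` off `𝒞_k` and `|w⁽ᵏ⁾|(M_k√(−τ) + ρ) ≤ K M_k`, `ρ(x) = √((x₁ + M_k)² + x₂²)`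
  (`= cylRadius (x − c_k)`, `c_k = −M_k e₁`); the printed estimates (the `I(M) → 0`
  computation, p. 13) are insensitive to the values of the constants.
* **The vertex value.** `|w⁽ᵏ⁾(0, 0)| = 1` is not a hypothesis; the conclusion is stated as
  `w⁽ᵏ⁾(0, 0) → 0`, which is what Steps 5–6 give for every subsequence (the limit `w` vanishes
  and the convergence is uniform on `B̄(0,1) × [−1, 0]`), and which the proof files contradict
  with `|w⁽ᵏ⁾(0, 0)| = 1`.
* **Per-`k` boundedness up to `τ = 0`** (`∃ L_k, |w⁽ᵏ⁾| ≤ L_k` on `ℝ³ × (A_k, 0]`) is recorded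
  because the printed Step 6 applies the representation formula to `w⁽ᵏ⁾ ∈ L^∞(ℝ³ × (−1, 0))`;
  it holds for the rescalings of `u` (bounded on `ℝ³ × (0, t_k]`) but does not follow from the
  three bounds, which degenerate inside `𝒞_k` as `τ → 0`.
* **Viscosity** `ν = 1` in the blow-up fact, as in print; the main step takes `ν > 0` and the
  proof files normalise by `IsClassicalNSSolutionOn.viscosityRescale_set`.

## References

* G. Koch, N. Nadirashvili, G. Seregin, V. Šverák, *Liouville theorems for the Navier–Stokes
  equations and applications*, Acta Math. 203 (2009) 83–105 = arXiv:0709.3599 (arXiv pages):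
  Theorem 6.2 (`typetwotime`) with (assumption1)–(assumption2), p. 12; its proof, pp. 12–13,
  displays (vk), (assumptionvk), (vkbound1), (vkbound2), (wk), (wkbound), (wkbound2),
  (wkbound3), the cylinders `𝒞_k`, the integral `I(M)`; Lemma 6.1 and Remark 6.1, p. 11;
  Theorem 6.1 and its proof (mildness under decay), pp. 11–12; Theorem 5.1, p. 9; Lemma 3.1,
  (3.3), (3.8), pp. 6–7; §4, p. 8. [KochNadirashviliSereginSverak2009]
-/

noncomputable section

open MeasureTheory Set Function Filter Topology TopologicalSpace
open scoped NNReal ENNReal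

namespace Literature.Analysis.FluidPDE

/-- Local notation for physical space `ℝ³ = EuclideanSpace ℝ (Fin 3)`. -/
local notation "ℝ³" => EuclideanSpace ℝ (Fin 3)

/-! ### The main step: `|x'| |u|` is bounded -/

/-- **KNSS 2009, proof of Theorem 6.2, main step** (Acta Math. 203 (2009) = arXiv:0709.3599,
pp. 12–13: "We define `f(x,t) = |x'| |u(x,t)|`, where, as above, `x' = (x₁, x₂)`. By
Theorem 6.1, it is enough to prove that `f` is bounded in `ℝ³ × (0, T)`", which the remainder of
the printed proof establishes by contradiction — blow-up sequence, two rescalings, compactness,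
the planar Liouville theorem and the representation formula at the vertex; module docstring,
Steps 2–6). **Statement**, in the rendering of `KNSS2009_regularity_typeI_rate`: let `ν > 0`,
`T > 0`, and let `(u, p)` be a classical solution of the unforced Navier–Stokes system on
`ℝ³ × (0, T)`, bounded on `ℝ³ × (0, T')` for every `T' < T`, with axisymmetric slices,
satisfying (assumption1) `√(T − t) ‖u(t, x)‖ ≤ C` on `(0, T) × ℝ³` and (assumption2)
`|x'| ‖u(t, x)‖ ≤ C'` whenever `|x'| ≥ R₀` (`|x'| = cylRadius x`), for some `R₀ > 0`. Then
`f = |x'| ‖u‖` is bounded on `(0, T) × ℝ³`. (KNSS: `ν = 1`; `ν > 0` by the viscosity scaling,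
which maps the hypotheses to themselves with other constants.) Reduced in the tree to
`KNSS2009_typeI_rate_blowupSequence` (Steps 5–6) by the proved Steps 2–4
(`KNSS2009_typeI_rate_rMulNorm_bounded_of_blowupSequence`). Users take
`(h : KNSS2009_typeI_rate_rMulNorm_bounded)`. [cite: KochNadirashviliSereginSverak2009, proof of Thm 6.2 (arXiv pp. 12–13), "By Theorem 6.1, it is enough to prove that f is bounded"] -/
def KNSS2009_typeI_rate_rMulNorm_bounded : Prop :=
  ∀ ⦃ν T : ℝ⦄ ⦃u : ℝ → ℝ³ → ℝ³⦄ ⦃p : ℝ → ℝ³ → ℝ⦄, 0 < ν → 0 < T →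
    IsClassicalNSSolutionOn (Ioo 0 T) ν 0 u p →
    (∀ T' < T, ∃ M : ℝ, ∀ t ∈ Ioo 0 T', ∀ x, ‖u t x‖ ≤ M) →
    (∀ t ∈ Ioo 0 T, IsAxisymmetric (u t)) →
    (∃ C : ℝ, ∀ t ∈ Ioo 0 T, ∀ x, Real.sqrt (T - t) * ‖u t x‖ ≤ C) →
    (∃ C R₀ : ℝ, 0 < R₀ ∧ ∀ t ∈ Ioo 0 T, ∀ x, R₀ ≤ cylRadius x → cylRadius x * ‖u t x‖ ≤ C) →
    ∃ C' : ℝ, ∀ t ∈ Ioo 0 T, ∀ x, cylRadius x * ‖u t x‖ ≤ C'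

/-! ### Steps 5–6: compactness, the planar Liouville theorem and the vertex -/

/-- **KNSS 2009, proof of Theorem 6.2, the compactness–Liouville–vertex step, in the form
used** (Acta Math. 203 (2009) = arXiv:0709.3599, p. 13, from "Since the functions `w⁽ᵏ⁾` are
mild solutions of the Navier–Stokes equations in `(A_k, 0)` …" to the end of the proof; it
invokes Lemma 6.1 (compactness of bounded mild solutions, p. 11, from §4), Theorem 5.1
(Liouville theorem in `ℝ² × (−∞, 0)`, p. 9), Remark 6.1 (a bounded ancient mild solution of
the form `b(t)` is constant, p. 11), the representation formula (3.3) with the kernel decay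
(3.8) (pp. 6–7) and the computation `I(M) → 0`; the mildness of the `w⁽ᵏ⁾` comes from Lemma 3.1
as in the proof of Theorem 6.1, p. 12). **Statement.** Let `C, K > 0`, let `M_k > 0` with
`M_k → ∞`, `A_k → −∞`, `B_k > 0`, and for each `k` let `(w⁽ᵏ⁾, q⁽ᵏ⁾)` be a classical solution
of the unforced Navier–Stokes system (`ν = 1`) on `ℝ³ × (A_k, B_k)` such that, writing
`c_k = −M_k e₁ = EuclideanSpace.single 0 (−M_k)` and `ρ_k(x) = cylRadius (x − c_k) =
√((x₁ + M_k)² + x₂²)` for the distance to the vertical axis through `c_k`: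
* `w⁽ᵏ⁾` is bounded on `ℝ³ × (A_k, 0]` (a bound depending on `k`; KNSS: `w⁽ᵏ⁾ ∈ L^∞`, needed
  for the representation formula on `(−1, 0)`);
* every slice `w⁽ᵏ⁾(·, τ)`, `τ ∈ (A_k, B_k)`, is axisymmetric about the vertical axis through
  `c_k`: `w⁽ᵏ⁾(c_k + R_θ(x − c_k), τ) = R_θ w⁽ᵏ⁾(x, τ)` ("the solutions `v⁽ᵏ⁾` are
  axi-symmetric", transported by (wk));
* (wkbound3) `√(−τ) ‖w⁽ᵏ⁾(x, τ)‖ ≤ C` for `A_k < τ < 0`;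
* (wkbound) `‖w⁽ᵏ⁾(x, τ)‖ ≤ K` for `A_k < τ ≤ 0` and `ρ_k(x) > M_k/2` (outside the cylinder
  `𝒞_k`);
* (wkbound2) `‖w⁽ᵏ⁾(x, τ)‖ (M_k √(−τ) + ρ_k(x)) ≤ K M_k` for `A_k < τ ≤ 0`.
Then `w⁽ᵏ⁾(0, 0) → 0` as `k → ∞`. (In print: along a subsequence `w⁽ᵏ⁾ → w` locally uniformly
on `ℝ³ × (−∞, 0)` with `w` a bounded ancient mild solution independent of `x₂`, `w = 0` by
Theorem 5.1 and Remark 6.1, and the convergence is uniform on `B̄(0, 1) × [−1, 0]`; applied to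
subsequences this is the stated limit. The constants `2` and `2CM_k/(M_k√(−τ) + Cρ)` of print
are replaced by `K`, module docstring "Constants".) Nothing here is in Mathlib or the tree;
users take `(h : KNSS2009_typeI_rate_blowupSequence)`. [cite: KochNadirashviliSereginSverak2009, proof of Thm 6.2, last two paragraphs (arXiv p. 13), with Lemma 6.1, Remark 6.1 (p. 11), Thm 5.1 (p. 9), (3.3), (3.8)] -/
def KNSS2009_typeI_rate_blowupSequence : Prop :=
  ∀ ⦃C K : ℝ⦄ ⦃M A B : ℕ → ℝ⦄ ⦃w : ℕ → ℝ → ℝ³ → ℝ³⦄ ⦃q : ℕ → ℝ → ℝ³ → ℝ⦄,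
    0 < C → 0 < K → (∀ k, 0 < M k) → Tendsto M atTop atTop → Tendsto A atTop atBot →
    (∀ k, 0 < B k) →
    (∀ k, IsClassicalNSSolutionOn (Ioo (A k) (B k)) 1 0 (w k) (q k)) →
    (∀ k, ∃ L : ℝ, ∀ τ ∈ Ioc (A k) 0, ∀ x, ‖w k τ x‖ ≤ L) →
    (∀ k, ∀ τ ∈ Ioo (A k) (B k), ∀ (θ : ℝ) (x : ℝ³),
      w k τ (EuclideanSpace.single 0 (-M k) + rotZ θ (x - EuclideanSpace.single 0 (-M k))) =
        rotZ θ (w k τ x)) →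
    (∀ k, ∀ τ ∈ Ioo (A k) 0, ∀ x, Real.sqrt (-τ) * ‖w k τ x‖ ≤ C) →
    (∀ k, ∀ τ ∈ Ioc (A k) 0, ∀ x,
      M k / 2 < cylRadius (x - EuclideanSpace.single 0 (-M k)) → ‖w k τ x‖ ≤ K) →
    (∀ k, ∀ τ ∈ Ioc (A k) 0, ∀ x,
      ‖w k τ x‖ * (M k * Real.sqrt (-τ) + cylRadius (x - EuclideanSpace.single 0 (-M k))) ≤
        K * M k) →
    Tendsto (fun k => w k 0 0) atTop (𝓝 0)

/-! ### Proved: Step 1, the reduction to Theorem 6.1 -/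

/-- **Theorem 6.2 from Theorem 6.1 and the main step** ("By Theorem 6.1, it is enough to prove
that `f` is bounded in `ℝ³ × (0, T)`", arXiv:0709.3599 p. 12): under the hypotheses of
`KNSS2009_regularity_typeI_rate`, the main step bounds `|x'| ‖u‖` on `(0, T) × ℝ³`, which is
the hypothesis of Theorem 6.1 (`KNSS2009_regularity_bound_C_over_r`), whose conclusion is the
bound on `u`. [cite: KochNadirashviliSereginSverak2009, proof of Thm 6.2, first paragraph (arXiv p. 12)] -/
theorem KNSS2009_regularity_typeI_rate_of_parts (h61 : KNSS2009_regularity_bound_C_over_r)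
    (hmain : KNSS2009_typeI_rate_rMulNorm_bounded) : KNSS2009_regularity_typeI_rate :=
  fun _ν _T _u _p hν hT h hbdd haxi hrate hdecay =>
    h61 hν hT h hbdd haxi (hmain hν hT h hbdd haxi hrate hdecay)

end Literature.Analysis.FluidPDE

end
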